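import Summits.QuantumFields.BalabanUV.T4Continuum.Spine.NE2.TorusBlockAveragePlaquette
import Summits.QuantumFields.BalabanUV.T4Continuum.Spine.NE2.ComposedAveragingMean

/-!
# T⁴ programme, spine node NE2 (U1a) — F6 (ζ) on the route's carriers, file 2: THE PLAQUETTE LETTERS OF A COHERENT AVERAGED TOWER FROM THE TOP ONE — `p_i ≤ 2·p_U/L^{2i}`
# (cell `pub-balaban-gaps`, seat ne2 gen 7; after `TorusBlockAveragePlaquette`)

File 1 transferred [B7] Prop. 1 (51) to the torus: ONE averaging step propagates the plaquette letter with the factor `L²` plus a quadratic correction.  THIS FILE iterates it DOWN a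
COHERENT tower `V_i = V̄[V_{i+1}]` (`i < k`) on the route's carriers `Tor (fine (lev L i) M)` (`lev L (i+1) = L·lev L i` definitionally, so `bavgTor (lev L i) L M` maps level `i+1` to
level `i`):
 * §1 real bookkeeping: the accumulated quadratic corrections `F_i = exp(2C·p_U·Σ_{i≤j<k} x^j)` (`x = L⁻²`): `F_k = 1`, `(1 + 2Cp_Ux^i)F_{i+1} ≤ F_i`, `F_i ≤ 2` under `8C·p_U ≤ 1`;
 * §2 **`tplaq_tower_le`**: contractive-unit-valued COHERENT tower, TOP letter `‖V_k(∂p) − 1‖ ≤ p_U·(L⁻²)^k` and ONE numerical threshold `8·C₀′·p_U ≤ 1` (`C₀′ = 226·(8(d+1)(d+4))²`,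
   [B7]'s explicit constant; it implies Prop. 1's smallness `512(d+1)(d+4)L²α₀ ≤ 1` at every step) ⟹ at EVERY level `i ≤ k`: `‖V_i(∂p) − 1‖ ≤ 2·p_U·(L⁻²)^i` — the letter shape
   `p_{k,i} ≤ p_U/L^{2i}` displayed by `ComposedRemainderGaugeTowerGeometric` (with `2p_U` for `p_U`), DERIVED from the finest level's letter for coherent data;
 * §3 `hol_one`, `bavg_one`, **`bavgTor_one`** (the average of the flat configuration is flat) ⟹ **`coherent_flat`** (non-vacuity of the coherence hypothesis).
NOT here: unitarity of `V̄` for unitary `V` (a coherent tower of UNITARY fields beyond the flat one — matrix-log skew-hermiticity, next), and the commutator-form hookup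
(`OneStepLoopHolonomy.norm_plaq_comm_eq`) with the ENDs' `hp`.
HONEST FRAMING (T4-DAG p. 1).  Elementary iteration of a PRINTED, tree-PROVED estimate on MODEL carriers; `V` is DATA; nothing of Bałaban's asserted beyond print; NOT NE2; **NE2 (U1a) NOT
PROVED**; spine PROVED 0/9 unchanged; NOT continuum YM / infinite volume / mass gap / Clay.  No `sorry`.
-/

noncomputable section

open scoped BigOperators

namespace Summit.QuantumFields.BalabanUV.T4Continuum.NE2.TorusAveragedTowerPlaquette

open Literature.MathematicalPhysics.QuantumFieldTheory.Balaban1983to89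
open Literature.MathematicalPhysics.QuantumFieldTheory.Balaban1983to89.B7Prop1Explicit (Site Letter hol stepHol seg Wcx Xavg bavg U1 expUnit hol_cons hol_nil)
open Literature.MathematicalPhysics.QuantumFieldTheory.Balaban1983to89.B5Prop11Plancherel (Tor fine unitVec)
open Literature.MathematicalPhysics.QuantumFieldTheory.Balaban1983to89.B5G183RateUnitTower (lev lev_neZero)
open Summit.QuantumFields.BalabanUV.T4Continuum.NE2.ComposedAveragingMean (geom_sum_le_two inv_le_half)
open Summit.QuantumFields.BalabanUV.T4Continuum.NE2.TorusBlockAveragePlaquette (liftCfg liftCfg_apply bavgTor tplaq tplaq_bavgTor_sub_one_le zrep)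

variable {d : ℕ}

/-! ## §1 Real bookkeeping: the accumulated quadratic corrections -/

/-- the accumulated quadratic correction factor `F_i = exp(2C·p_U·Σ_{i ≤ j < k} x^j)`. [folklore] -/
def corrF (C pU x : ℝ) (k i : ℕ) : ℝ := Real.exp (2 * C * pU * ∑ j ∈ Finset.Ico i k, x ^ j)

/-- `0 < F_i`. [folklore] -/
theorem corrF_pos (C pU x : ℝ) (k i : ℕ) : 0 < corrF C pU x k i := Real.exp_pos _

/-- `F_k = 1`. [folklore] -/
theorem corrF_top (C pU x : ℝ) (k : ℕ) : corrF C pU x k k = 1 := by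
  unfold corrF; rw [Finset.Ico_self, Finset.sum_empty, mul_zero, Real.exp_zero]

/-- the recursion inequality `(1 + 2C·p_U·x^i)·F_{i+1} ≤ F_i` (`i < k`). [folklore] -/
theorem corrF_step {C pU x : ℝ} {k i : ℕ} (hik : i < k) :
    (1 + 2 * C * pU * x ^ i) * corrF C pU x k (i + 1) ≤ corrF C pU x k i := by
  unfold corrF
  rw [Finset.sum_eq_sum_Ico_succ_bot hik, mul_add, Real.exp_add]
  exact mul_le_mul_of_nonneg_right (by linarith [Real.add_one_le_exp (2 * C * pU * x ^ i)]) (Real.exp_pos _).le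

/-- `F_i ≤ 2` for `0 ≤ x ≤ ½` and `8C·p_U ≤ 1` (the sum is `≤ 2`, so the exponent is `≤ 4Cp_U ≤ ½`, and `e^{1/2} ≤ 2`). [folklore] -/
theorem corrF_le_two {C pU x : ℝ} (hC : 0 ≤ C) (hpU : 0 ≤ pU) (hx0 : 0 ≤ x) (hx : x ≤ 1 / 2) (hth : 8 * C * pU ≤ 1) (k i : ℕ) : corrF C pU x k i ≤ 2 := by
  unfold corrF
  have hs : ∑ j ∈ Finset.Ico i k, x ^ j ≤ 2 := by
    calc ∑ j ∈ Finset.Ico i k, x ^ j ≤ ∑ j ∈ Finset.range k, x ^ j := by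
          rw [Finset.range_eq_Ico]
          exact Finset.sum_le_sum_of_subset_of_nonneg (Finset.Ico_subset_Ico (Nat.zero_le i) le_rfl) fun j _ _ => pow_nonneg hx0 j
      _ ≤ 2 := by linarith [geom_sum_le_two hx0 hx k, pow_nonneg hx0 k]
  have he : 2 * C * pU * ∑ j ∈ Finset.Ico i k, x ^ j ≤ 1 / 2 := by
    have : 2 * C * pU * ∑ j ∈ Finset.Ico i k, x ^ j ≤ 2 * C * pU * 2 := mul_le_mul_of_nonneg_left hs (by positivity)
    linarith
  calc Real.exp (2 * C * pU * ∑ j ∈ Finset.Ico i k, x ^ j) ≤ Real.exp (1 / 2) := Real.exp_le_exp.mpr he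
    _ ≤ 1 / (1 - 1 / 2) := Real.exp_bound_div_one_sub_of_interval (by norm_num) (by norm_num)
    _ = 2 := by norm_num

/-! ## §2 The letters of a coherent tower from the top one -/

section Tower

variable {𝔸 : Type*} [NormedRing 𝔸] [NormOneClass 𝔸] [NormedAlgebra ℂ 𝔸] [CompleteSpace 𝔸]
variable (L : ℕ) [NeZero L] (M : Fin d → ℕ) [hM : ∀ μ, NeZero (M μ)]

/-- [B7]'s explicit quadratic constant `C₀′ = 226·(8(d+1)(d+4))²` of `prop1_explicit`. [cite: Balaban1985Averaging, Prop. 1 (51) p.26] [folklore] -/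
def C0' (d : ℕ) : ℝ := 226 * (8 * (d + 1) * (d + 4)) ^ 2

/-- **THE PLAQUETTE LETTERS OF A COHERENT AVERAGED TOWER FROM THE TOP ONE**: for a tower `V_i` of contractive-unit-valued bond configurations on `Tor (fine (lev L i) M)` with
`V_i = V̄[V_{i+1}]` (`i < k`), the top letter `‖V_k(∂p) − 1‖ ≤ p_U·(L⁻²)^k` and `8·C₀′·p_U ≤ 1`, EVERY level satisfies `‖V_i(∂p) − 1‖ ≤ 2·p_U·(L⁻²)^i` (`i ≤ k`, `L ≥ 2`).
[cite: Balaban1985Averaging, Prop. 1 (51) p.26 (iterated)] [folklore] -/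
theorem tplaq_tower_le (hL : 2 ≤ L) (k : ℕ) (V : (i : ℕ) → Tor (fine (lev L i) M) → Fin d → 𝔸ˣ) (hV : ∀ i y κ, V i y κ ∈ U1 𝔸)
    (hcoh : ∀ i, i < k → V i = bavgTor (lev L i) L M (V (i + 1))) {pU : ℝ} (hpU : 0 ≤ pU) (hth : 8 * C0' d * pU ≤ 1)
    (htop : ∀ (y : Tor (fine (lev L k) M)) (μ ν : Fin d), μ ≠ ν → ‖((tplaq (V k) y μ ν : 𝔸ˣ) : 𝔸) - 1‖ ≤ pU * (((L : ℝ)⁻¹) ^ 2) ^ k)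
    {i : ℕ} (hi : i ≤ k) (y : Tor (fine (lev L i) M)) {μ ν : Fin d} (hμν : μ ≠ ν) :
    ‖((tplaq (V i) y μ ν : 𝔸ˣ) : 𝔸) - 1‖ ≤ 2 * pU * (((L : ℝ)⁻¹) ^ 2) ^ i := by
  obtain ⟨h0, h2⟩ := inv_le_half hL
  have hL1 : 1 ≤ L := by omega
  have hLr : (0 : ℝ) < L := by exact_mod_cast (by omega : 0 < L)
  set x : ℝ := ((L : ℝ)⁻¹) ^ 2 with hx
  have hx0 : 0 ≤ x := pow_nonneg h0 2
  have hx2 : x ≤ 1 / 2 := by rw [hx]; nlinarith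
  have hLx : (L : ℝ) ^ 2 * x = 1 := by rw [hx, ← mul_pow, mul_inv_cancel₀ hLr.ne', one_pow]
  have hC : 0 ≤ C0' d := by unfold C0'; positivity
  have hd0 : (0 : ℝ) ≤ d := Nat.cast_nonneg d
  -- the Prop-1 smallness follows from the threshold
  have hS : 2 * (512 * (d + 1) * (d + 4) : ℝ) * pU ≤ 1 := by
    have h2 : 2 * (512 * (d + 1) * (d + 4) : ℝ) * pU ≤ 8 * C0' d * pU := by
      unfold C0'
      set t : ℝ := ((d : ℝ) + 1) * ((d : ℝ) + 4) with ht
      have ht1 : 1 ≤ t := by rw [ht]; nlinarith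
      have ht2 : t ≤ t ^ 2 := by nlinarith
      have : 2 * (512 * ((d : ℝ) + 1) * (d + 4)) ≤ 8 * (226 * (8 * ((d : ℝ) + 1) * (d + 4)) ^ 2) := by
        calc 2 * (512 * ((d : ℝ) + 1) * (d + 4)) = 1024 * t := by rw [ht]; ring
          _ ≤ 115712 * t ^ 2 := by nlinarith
          _ = 8 * (226 * (8 * ((d : ℝ) + 1) * (d + 4)) ^ 2) := by rw [ht]; ring
      exact mul_le_mul_of_nonneg_right this hpU
    linarith
  have hF2 : ∀ j, corrF (C0' d) pU x k j ≤ 2 := fun j => corrF_le_two hC hpU hx0 hx2 hth k j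
  -- downward induction with the invariant `≤ p_U x^i F_i`
  have key : ∀ n i, i + n = k → ∀ (y : Tor (fine (lev L i) M)) (μ ν : Fin d), μ ≠ ν →
      ‖((tplaq (V i) y μ ν : 𝔸ˣ) : 𝔸) - 1‖ ≤ pU * x ^ i * corrF (C0' d) pU x k i := by
    intro n
    induction n with
    | zero =>
      intro i hik y μ ν hμν
      rw [add_zero] at hik; subst hik
      rw [corrF_top, mul_one]; exact htop y μ ν hμν
    | succ n ih =>
      intro i hik y μ ν hμν
      have hik' : i < k := by omega
      have hI := ih (i + 1) (by omega)
      set α₀ : ℝ := pU * x ^ (i + 1) * corrF (C0' d) pU x k (i + 1) with hα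
      have hα0 : 0 ≤ α₀ := by have := corrF_pos (C0' d) pU x k (i + 1); positivity
      have hu : (L : ℝ) ^ 2 * α₀ = pU * x ^ i * corrF (C0' d) pU x k (i + 1) := by
        rw [hα, pow_succ]
        calc (L : ℝ) ^ 2 * (pU * (x ^ i * x) * corrF (C0' d) pU x k (i + 1)) = ((L : ℝ) ^ 2 * x) * (pU * x ^ i * corrF (C0' d) pU x k (i + 1)) := by ring
          _ = _ := by rw [hLx, one_mul]
      have hxi : x ^ i ≤ 1 := pow_le_one₀ hx0 (by linarith)
      have hu1 : (L : ℝ) ^ 2 * α₀ ≤ 2 * pU := by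
        rw [hu]
        calc pU * x ^ i * corrF (C0' d) pU x k (i + 1) ≤ pU * 1 * 2 := mul_le_mul (mul_le_mul_of_nonneg_left hxi hpU) (hF2 _) (corrF_pos _ _ _ _ _).le (by positivity)
          _ = 2 * pU := by ring
      have hsmall : 512 * (d + 1) * (d + 4) * (L : ℝ) ^ 2 * α₀ ≤ 1 := by
        calc 512 * (d + 1) * (d + 4) * (L : ℝ) ^ 2 * α₀ = (512 * (d + 1) * (d + 4) : ℝ) * ((L : ℝ) ^ 2 * α₀) := by ring
          _ ≤ (512 * (d + 1) * (d + 4) : ℝ) * (2 * pU) := mul_le_mul_of_nonneg_left hu1 (by positivity)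
          _ ≤ 1 := by linarith
      haveI := lev_neZero L i
      have hstep := tplaq_bavgTor_sub_one_le (lev L i) L M hL1 (V (i + 1)) (hV (i + 1)) hα0 hsmall (fun y' κ κ' hκ => hI y' κ κ' hκ) y hμν
      rw [hcoh i hik']
      refine hstep.trans ?_
      have e226 : (226 : ℝ) * (8 * (d + 1) * (d + 4) * (L : ℝ) ^ 2 * α₀) ^ 2 = C0' d * ((L : ℝ) ^ 2 * α₀) ^ 2 := by unfold C0'; ring
      rw [e226, hu]
      set u : ℝ := pU * x ^ i * corrF (C0' d) pU x k (i + 1) with hudef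
      have hu0 : 0 ≤ u := by have := corrF_pos (C0' d) pU x k (i + 1); positivity
      have hCu : C0' d * u ≤ 2 * C0' d * pU * x ^ i := by
        rw [hudef]
        have := mul_le_mul_of_nonneg_left (hF2 (i + 1)) (by positivity : 0 ≤ C0' d * pU * x ^ i)
        nlinarith
      calc u + C0' d * u ^ 2 = u * (1 + C0' d * u) := by ring
        _ ≤ u * (1 + 2 * C0' d * pU * x ^ i) := mul_le_mul_of_nonneg_left (by linarith) hu0
        _ = pU * x ^ i * ((1 + 2 * C0' d * pU * x ^ i) * corrF (C0' d) pU x k (i + 1)) := by rw [hudef]; ring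
        _ ≤ pU * x ^ i * corrF (C0' d) pU x k i := mul_le_mul_of_nonneg_left (corrF_step hik') (by positivity)
  obtain ⟨n, rfl⟩ := Nat.exists_eq_add_of_le hi
  calc ‖((tplaq (V i) y μ ν : 𝔸ˣ) : 𝔸) - 1‖ ≤ pU * x ^ i * corrF (C0' d) pU x (i + n) i := key n i rfl y μ ν hμν
    _ ≤ pU * x ^ i * 2 := mul_le_mul_of_nonneg_left (hF2 i) (by positivity)
    _ = 2 * pU * x ^ i := by ring

end Tower

/-! ## §3 The flat tower is coherent -/

section Flat

variable {G : Type*} [Group G]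

/-- transport of the flat configuration is trivial. [folklore] -/
theorem hol_one : ∀ (x : Site d) (w : List (Letter d)), hol (fun (_ : Site d) (_ : Fin d) => (1 : G)) x w = 1
  | x, [] => hol_nil _ _
  | x, l :: w => by
      rw [hol_cons, hol_one (x + l.vec) w, mul_one]
      unfold stepHol; split_ifs <;> simp

variable {𝔸 : Type*} [NormedRing 𝔸] [NormOneClass 𝔸] [NormedAlgebra ℂ 𝔸] [CompleteSpace 𝔸] (L : ℕ)

omit [NormOneClass 𝔸] in
/-- **the average (42) of the flat configuration is flat**. [folklore] -/
theorem bavg_one (q : Site d) (κ : Fin d) : bavg L (fun (_ : Site d) (_ : Fin d) => (1 : 𝔸ˣ)) q κ = 1 := by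
  have hX : Xavg L (fun (_ : Site d) (_ : Fin d) => (1 : 𝔸ˣ)) q κ = 0 := by
    unfold Xavg Wcx
    simp only [hol_one, mul_one, inv_one, Units.val_one, MatrixLog.mlog_one, smul_zero, Finset.sum_const_zero]
  unfold bavg
  rw [hol_one, mul_one, hX]
  ext
  show NormedSpace.exp (0 : 𝔸) = 1
  exact NormedSpace.exp_zero

variable (N : ℕ) [NeZero N] [NeZero L] (M : Fin d → ℕ) [hM : ∀ μ, NeZero (M μ)]

omit [NormOneClass 𝔸] [NeZero N] [NeZero L] hM in
/-- **the torus average of the flat configuration is flat**. [folklore] -/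
theorem bavgTor_one : bavgTor N L M (fun (_ : Tor (fine (L * N) M)) (_ : Fin d) => (1 : 𝔸ˣ)) = fun _ _ => 1 := by
  funext y κ
  exact bavg_one L (zrep N L M y) κ

omit [NormOneClass 𝔸] [NeZero N] [NeZero L] hM in
/-- **NON-VACUITY OF THE COHERENCE HYPOTHESIS**: the flat tower `V_i ≡ 1` is coherent. [folklore] -/
theorem coherent_flat (k i : ℕ) (_hik : i < k) :
    (fun (_ : Tor (fine (lev L i) M)) (_ : Fin d) => (1 : 𝔸ˣ)) = bavgTor (lev L i) L M (fun (_ : Tor (fine (L * lev L i) M)) (_ : Fin d) => (1 : 𝔸ˣ)) := by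
  rw [bavgTor_one]

end Flat

end Summit.QuantumFields.BalabanUV.T4Continuum.NE2.TorusAveragedTowerPlaquette

end
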